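import Literature.Topology.FourManifolds.BandSumIsotopyRegularProofs
import HarnessLib

/-!
# Band sums with the same regular band: retired conditional derivation (tombstone)

Fact seat `provefact-Literature.Topology.FourManifolds.BandData.isIsotopic_of_band_eq`. This module
used to derive the corrected geometric heart
`Literature.Topology.FourManifolds.BandData.exists_ambientIsotopy_of_band_eq_of_isRegular` and the
corrected printed theorem `Literature.Topology.FourManifolds.BandData.isIsotopic_of_band_eq_of_isRegular`
(`BandSumIsotopyRegular.lean`) from a 2-dimensional named fact (two proper arcs in a half-disc are
ambient isotopic rel boundary — a statement of the strength of the smooth Schoenflies theorem in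
the plane). Both facts are now **proved outright** in `BandSumIsotopyRegularProofs.lean`
(`BandData.exists_ambientIsotopy_of_band_eq_of_isRegular_holds`,
`BandData.isIsotopic_of_band_eq_of_isRegular_holds`: the lifted-arc construction, which moves the
two arc windows through embedded *space* arcs in the thickened band and needs no planar isotopy),
so the 2-dimensional fact was retired at the review of its decomposition (D-0026) and the three
conditional theorems of this module went with it. Consumers use the two `_holds` theorems, or the
knot-level form `Knot.IsBandSum.isIsotopic_of_eq_band_of_isRegular` (`BandSumIsotopyRegular.lean`)
fed with `BandData.isIsotopic_of_band_eq_of_isRegular_holds`.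

The module is kept (rather than deleted) so that the module name stays resolvable; it declares
one consumer convenience only.

## References

* R. E. Gompf, A. I. Stipsicz, *4-Manifolds and Kirby Calculus* (1999), §5.1 (band sums along a
  given band). [GompfStipsicz1999]
* P. R. Cromwell, *Knots and Links* (2004), §4.6 (the product of oriented knots along an embedded
  rectangle is well defined). [Cromwell2004]

## Design notes

* Theorems only; nothing here uses `sorry`; no statement of another file is modified.
-/

open scoped Manifold ContDiff Topology Real
open Function Set Metric

noncomputable section

namespace Literature.Topology.FourManifolds

/-- **A band sum along a regular band depends only on the band — regularity read off either
datum.** Two band sums of `K₁`, `K₂` with the same band map and collar width are isotopic as soon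
as *one* of the two band data is regular (`BandData.IsRegular`; regularity depends only on the band
map and the collar width, `BandData.IsRegular.of_band_eq`), by the proved printed theorem
`BandData.isIsotopic_of_band_eq_of_isRegular_holds`. Gompf–Stipsicz (1999), §5.1; Cromwell (2004),
§4.6. [cite: GompfStipsicz1999, §5.1] -/
theorem BandData.isIsotopic_of_band_eq_of_isRegular_or {K₁ K₂ K K' : Knot}
    {avoid avoid' : Set (sphere (0 : EuclideanSpace ℝ (Fin 4)) 1)}
    (b : BandData K₁ K₂ K avoid) (b' : BandData K₁ K₂ K' avoid') (hreg : b.IsRegular ∨ b'.IsRegular)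
    (band_eq : b.band = b'.band) (δ_eq : b.δ = b'.δ) : K.IsIsotopic K' := by
  rcases hreg with hreg | hreg'
  · exact BandData.isIsotopic_of_band_eq_of_isRegular_holds b b' hreg band_eq δ_eq
  · exact BandData.isIsotopic_of_band_eq_of_isRegular_holds b b'
      (hreg'.of_band_eq band_eq.symm δ_eq.symm) band_eq δ_eq

end Literature.Topology.FourManifolds
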